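import Summits.QuantumFields.BalabanUV.T4Continuum.Support.NE3QuadRemainderGaugeStep
import HarnessLib

/-!
# NE7OneStepCornerForm — ONE STEP OF THE NONLINEAR AVERAGING TOWER IN CORNER FORM (memo ROAD-G102 §9 STEP 1, §10)

Cell `pub-balaban`, lineage `t4-ne7-p1` (CRUX PROVER NE7 #1, owner of BINDER row NE7), gen 102.  Row NE3's exact three-factor form
`NE3QuadRemainderGaugeStep.relStep_gaugeDir_add` says that one B7 averaging step maps a field with a gauge component,
`X = gaugeDir V Λ + R`, to `relStep L V X (y,κ) = log( e^{Ad_{V̄(y,κ)⁻¹}Λ(L•y)} · e^{relStep L V R′ (y,κ)} · e^{−Λ(L•(y+e_κ))} )`, `R′ = gaugeExtract V Λ R`.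
Its tree companion `norm_relStep_gaugeDir_add_sub_le` linearises ALL THREE factors (ends form, charges `≤ 1∕8192`).  THIS file keeps the two
corner factors NONLINEAR and linearises only the middle one: with NO smallness of the charges beyond the `1∕64` of the exact form,
`‖relStep L V X (y,κ) − log( e^{Ad_{V̄⁻¹}Λ(L•y)} · e^{−Λ(L•(y+e_κ))} )‖ ≤ 3·‖relStep L V R′ (y,κ)‖ ≤ 3·(‖cpush L V R′ (y,κ)‖ + 2(r∕ρ₀)²)`
— one averaging step IS the corner nonlinearity `G_{V̄}(Λ∘(L•))` of the charges up to a term LINEAR in the extracted straight field.  Iterated,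
this is the mechanism behind memo §10: corner charges of successive levels compose as a GROUP PRODUCT at the corner (`e^{Λ}·e^{δ}`), not as
the sum the linear frames `framePotW` record.

Contents: `norm_exp3_sub_exp2_le` (`‖e^{a}e^{ρ}e^{−b} − e^{a}e^{−b}‖ ≤ (1+2ℓ)²·2‖ρ‖`), `norm_exp2_sub_one_le`, `norm_exp3_sub_one_le` (the `1∕4`-ball
conditions), `norm_mlog_exp3_sub_mlog_exp2_le` (pure matrix form, constant `3`), `norm_relStep_gaugeDir_add_sub_corner_le` (the step),
`norm_relStep_gaugeDir_add_sub_corner_le_sup` (with Π-C-2's one-step remainder `NE3QuadRemainderTower.norm_relStep_le`).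
-/

set_option autoImplicit false

open scoped BigOperators Matrix.Norms.L2Operator
open NormedSpace Finset

namespace Summit.QuantumFields.BalabanUV.T4Continuum.NE7OneStepCornerForm

open Literature.MathematicalPhysics.QuantumFieldTheory.Balaban1983to89
open B7Prop1Explicit B7Prop2Explicit MatrixLog
open T4AveragingDeficitWall (IsSkewDir IsUnitaryCfg SmallField vary Ad)
open AveragingDeficitChartCalculus (cavg)
open AveragingDeficitMultiLevelPrep (cpush)
open AveragingDeficitTransport (norm_Ad_of_unitary)
open AveragingDeficitTwoLevelPrep (cavg_isUnitaryCfg)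
open BlockAverageVaryDisc (rho0)
open BlockAveragePushDirGauge (gaugeDir)
open BlockAverageGaugeExtract (gaugeExtract)
open BlockAverageLogInteraction (norm_exp_sub_one_le_two_mul norm_mul3_sub_one_le)
open NE3QuadRemainderTower (relStep norm_relStep_le)
open NE3QuadRemainderGaugeStep (relStep_gaugeDir_add)

noncomputable section

variable {d : ℕ} {n : Type*} [Fintype n] [DecidableEq n] [Nonempty n]

/-! ## §1 Three factors against two: pure matrix estimates -/

/-- `‖e^{a}·e^{ρ}·e^{−b} − e^{a}·e^{−b}‖ ≤ (1 + 2ℓ)²·(2‖ρ‖)` for `‖a‖, ‖b‖ ≤ ℓ ≤ 1`, `‖ρ‖ ≤ 1` (the middle factor is linearised, the corner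
factors only bounded). [folklore] -/
theorem norm_exp3_sub_exp2_le {a ρ b : Matrix n n ℂ} {ℓ : ℝ} (ha : ‖a‖ ≤ ℓ) (hb : ‖b‖ ≤ ℓ) (hℓ : ℓ ≤ 1) (hρ : ‖ρ‖ ≤ 1) :
    ‖exp a * exp ρ * exp (-b) - exp a * exp (-b)‖ ≤ (1 + 2 * ℓ) ^ 2 * (2 * ‖ρ‖) := by
  have hℓ0 : 0 ≤ ℓ := (norm_nonneg a).trans ha
  have hea : ‖exp a‖ ≤ 1 + 2 * ℓ := (norm_exp_sub_one_le_two_mul ha hℓ).2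
  have heb : ‖exp (-b)‖ ≤ 1 + 2 * ℓ := (norm_exp_sub_one_le_two_mul (by rwa [norm_neg]) hℓ).2
  have heρ : ‖exp ρ - 1‖ ≤ 2 * ‖ρ‖ := (norm_exp_sub_one_le_two_mul le_rfl hρ).1
  have hid : exp a * exp ρ * exp (-b) - exp a * exp (-b) = exp a * (exp ρ - 1) * exp (-b) := by noncomm_ring
  rw [hid]
  calc ‖exp a * (exp ρ - 1) * exp (-b)‖ ≤ ‖exp a‖ * ‖exp ρ - 1‖ * ‖exp (-b)‖ :=
        (norm_mul_le _ _).trans (mul_le_mul_of_nonneg_right (norm_mul_le _ _) (norm_nonneg _))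
    _ ≤ (1 + 2 * ℓ) * (2 * ‖ρ‖) * (1 + 2 * ℓ) := by gcongr
    _ = (1 + 2 * ℓ) ^ 2 * (2 * ‖ρ‖) := by ring

/-- `‖e^{a}·e^{−b} − 1‖ ≤ (1 + 2‖a‖)(1 + 2‖b‖) − 1` for `‖a‖, ‖b‖ ≤ 1`. [folklore] -/
theorem norm_exp2_sub_one_le {a b : Matrix n n ℂ} (ha : ‖a‖ ≤ 1) (hb : ‖b‖ ≤ 1) :
    ‖exp a * exp (-b) - 1‖ ≤ (1 + 2 * ‖a‖) * (1 + 2 * ‖b‖) - 1 := by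
  have h1 : ‖exp a - 1‖ ≤ 2 * ‖a‖ := (norm_exp_sub_one_le_two_mul le_rfl ha).1
  have h2 : ‖exp (-b) - 1‖ ≤ 2 * ‖b‖ := (norm_exp_sub_one_le_two_mul (le_of_eq (norm_neg b)) hb).1
  have h3 : ‖(1 : Matrix n n ℂ) - 1‖ ≤ 0 := by rw [sub_self, norm_zero]
  have h := norm_mul3_sub_one_le h1 h2 h3
  rw [mul_one] at h
  linarith

/-- `‖e^{a}·e^{ρ}·e^{−b} − 1‖ ≤ (1 + 2‖a‖)(1 + 2‖ρ‖)(1 + 2‖b‖) − 1` for `‖a‖, ‖ρ‖, ‖b‖ ≤ 1`. [folklore] -/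
theorem norm_exp3_sub_one_le {a ρ b : Matrix n n ℂ} (ha : ‖a‖ ≤ 1) (hρ : ‖ρ‖ ≤ 1) (hb : ‖b‖ ≤ 1) :
    ‖exp a * exp ρ * exp (-b) - 1‖ ≤ (1 + 2 * ‖a‖) * (1 + 2 * ‖ρ‖) * (1 + 2 * ‖b‖) - 1 := by
  have h1 : ‖exp a - 1‖ ≤ 2 * ‖a‖ := (norm_exp_sub_one_le_two_mul le_rfl ha).1
  have h2 : ‖exp ρ - 1‖ ≤ 2 * ‖ρ‖ := (norm_exp_sub_one_le_two_mul le_rfl hρ).1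
  have h3 : ‖exp (-b) - 1‖ ≤ 2 * ‖b‖ := (norm_exp_sub_one_le_two_mul (le_of_eq (norm_neg b)) hb).1
  exact norm_mul3_sub_one_le h1 h2 h3

/-- **THREE FACTORS AGAINST TWO, THROUGH THE LOGARITHM**: for `‖a‖, ‖b‖ ≤ 1∕64` and `‖ρ‖ ≤ 1∕32`,
`‖log(e^{a}·e^{ρ}·e^{−b}) − log(e^{a}·e^{−b})‖ ≤ 3·‖ρ‖` (both products lie in the `1∕4`-ball around `1`, where `log` is `4∕3`-Lipschitz:
`FederbushMean.norm_mlog_sub_mlog_le`). No smallness of `a`, `b` relative to `ρ` is used. [folklore] -/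
theorem norm_mlog_exp3_sub_mlog_exp2_le {a ρ b : Matrix n n ℂ} (ha : ‖a‖ ≤ 1 / 64) (hρ : ‖ρ‖ ≤ 1 / 32) (hb : ‖b‖ ≤ 1 / 64) :
    ‖mlog (exp a * exp ρ * exp (-b)) - mlog (exp a * exp (-b))‖ ≤ 3 * ‖ρ‖ := by
  have ha0 := norm_nonneg a
  have hb0 := norm_nonneg b
  have hρ0 := norm_nonneg ρ
  have ha1 : ‖a‖ ≤ 1 := ha.trans (by norm_num)
  have hb1 : ‖b‖ ≤ 1 := hb.trans (by norm_num)
  have hρ1 : ‖ρ‖ ≤ 1 := hρ.trans (by norm_num)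
  -- both products in the `1/4`-ball
  have hA : ‖exp a * exp ρ * exp (-b) - 1‖ ≤ 1 / 4 := by
    refine (norm_exp3_sub_one_le ha1 hρ1 hb1).trans ?_
    nlinarith [mul_nonneg ha0 hb0, mul_nonneg ha0 hρ0, mul_nonneg hρ0 hb0, mul_nonneg (mul_nonneg ha0 hρ0) hb0]
  have hB : ‖exp a * exp (-b) - 1‖ ≤ 1 / 4 := by
    refine (norm_exp2_sub_one_le ha1 hb1).trans ?_
    nlinarith [mul_nonneg ha0 hb0]
  have hlip := FederbushMean.norm_mlog_sub_mlog_le (𝔸 := Matrix n n ℂ) (ρ := 1 / 4) (by norm_num) hA hB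
  -- the difference of the products is linear in `ρ`
  have hdiff : ‖exp a * exp ρ * exp (-b) - exp a * exp (-b)‖ ≤ (1 + 2 * (1 / 64 : ℝ)) ^ 2 * (2 * ‖ρ‖) :=
    norm_exp3_sub_exp2_le ha hb (by norm_num) hρ1
  calc ‖mlog (exp a * exp ρ * exp (-b)) - mlog (exp a * exp (-b))‖
      ≤ (1 + 1 / 4 / (1 - 1 / 4)) * ‖exp a * exp ρ * exp (-b) - exp a * exp (-b)‖ := hlip
    _ ≤ (1 + 1 / 4 / (1 - 1 / 4)) * ((1 + 2 * (1 / 64 : ℝ)) ^ 2 * (2 * ‖ρ‖)) := by gcongr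
    _ ≤ 3 * ‖ρ‖ := by nlinarith

/-! ## §2 One averaging step in corner form -/

/-- **ONE STEP OF THE NONLINEAR TOWER IN CORNER FORM.**  In the setting of `NE3QuadRemainderGaugeStep.relStep_gaugeDir_add` (`L ≥ 1`, unitary `V` of
plaquette radius `a`, skew charges `Λ` below `1∕64`, skew `R` below `1∕64`, extracted field `R′ = gaugeExtract V Λ R` of sup `≤ r ≤ min(1, ρ₀∕4)`, class
line `512(d+1)(d+4)L²(a+8r) ≤ 1`) and with `‖relStep L V R′ (y,κ)‖ ≤ 1∕32`: the one-step relative coordinate of `X = gaugeDir V Λ + R` IS the corner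
nonlinearity of the charges up to a term linear in the extracted straight field,
`‖relStep L V X (y,κ) − log( e^{Ad_{V̄(y,κ)⁻¹}Λ(L•y)} · e^{−Λ(L•(y+e_κ))} )‖ ≤ 3·‖relStep L V R′ (y,κ)‖`. [folklore] -/
theorem norm_relStep_gaugeDir_add_sub_corner_le {L : ℕ} (hL : 1 ≤ L) {V : Site d → Fin d → (Matrix n n ℂ)ˣ} (hVu : IsUnitaryCfg V)
    {a : ℝ} (ha : 0 ≤ a) (hVa : SmallField V a) {Λ : Site d → Matrix n n ℂ} (hΛ : ∀ x, Λ x ∈ skewAdjoint (Matrix n n ℂ))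
    (hΛs : ∀ x, ‖Λ x‖ < 1 / 64) {R : Site d → Fin d → Matrix n n ℂ} (hR : IsSkewDir R) (hRs : ∀ x μ, ‖R x μ‖ < 1 / 64)
    {r : ℝ} (hr : ∀ x μ, ‖gaugeExtract V Λ R x μ‖ ≤ r) (hr1 : r ≤ 1) (hrρ : r ≤ rho0 d L / 4)
    (hsmall : 512 * (d + 1) * (d + 4) * (L : ℝ) ^ 2 * (a + 8 * r) ≤ 1) (y : Site d) (κ : Fin d)
    (hρ : ‖relStep L V (gaugeExtract V Λ R) y κ‖ ≤ 1 / 32) :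
    ‖relStep L V (gaugeDir V Λ + R) y κ
        - mlog (exp (Ad (cavg L V y κ)⁻¹ (Λ ((L : ℤ) • y))) * exp (-(Λ ((L : ℤ) • (y + e κ)))))‖
      ≤ 3 * ‖relStep L V (gaugeExtract V Λ R) y κ‖ := by
  have hsmall0 : 512 * (d + 1) * (d + 4) * (L : ℝ) ^ 2 * a ≤ 1 := by
    have hr0 : 0 ≤ r := (norm_nonneg _).trans (hr y κ)
    have : 512 * (d + 1) * (d + 4) * (L : ℝ) ^ 2 * a ≤ 512 * (d + 1) * (d + 4) * (L : ℝ) ^ 2 * (a + 8 * r) :=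
      mul_le_mul_of_nonneg_left (by linarith) (by positivity)
    exact this.trans hsmall
  rw [relStep_gaugeDir_add hL hVu ha hVa hΛ hΛs hR hRs hr hr1 hrρ hsmall y κ]
  have hVbar : cavg L V y κ ∈ unitaryUnits (Matrix n n ℂ) := cavg_isUnitaryCfg hL hVu ha hsmall0 hVa y κ
  have hna : ‖Ad (cavg L V y κ)⁻¹ (Λ ((L : ℤ) • y))‖ = ‖Λ ((L : ℤ) • y)‖ := norm_Ad_of_unitary ((unitaryUnits _).inv_mem hVbar) _
  exact norm_mlog_exp3_sub_mlog_exp2_le (by rw [hna]; exact (hΛs _).le) hρ (hΛs _).le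

/-- **CORNER FORM WITH THE ONE-STEP REMAINDER DISPLAYED** (the previous theorem and Π-C-2's `NE3QuadRemainderTower.norm_relStep_le` on the skew extracted
field `R′` of sup `≤ r`): `‖relStep L V X (y,κ) − log( e^{Ad_{V̄⁻¹}Λ(L•y)} · e^{−Λ(L•(y+e_κ))} )‖ ≤ 3·(‖cpush L V R′ (y,κ)‖ + 2(r∕ρ₀)²)`, provided the
right-hand bracket is `≤ 1∕32`. [folklore] -/
theorem norm_relStep_gaugeDir_add_sub_corner_le_sup {L : ℕ} (hL : 1 ≤ L) {V : Site d → Fin d → (Matrix n n ℂ)ˣ} (hVu : IsUnitaryCfg V)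
    {a : ℝ} (ha : 0 ≤ a) (hVa : SmallField V a) {Λ : Site d → Matrix n n ℂ} (hΛ : ∀ x, Λ x ∈ skewAdjoint (Matrix n n ℂ))
    (hΛs : ∀ x, ‖Λ x‖ < 1 / 64) {R : Site d → Fin d → Matrix n n ℂ} (hR : IsSkewDir R) (hRs : ∀ x μ, ‖R x μ‖ < 1 / 64)
    {r : ℝ} (hr : ∀ x μ, ‖gaugeExtract V Λ R x μ‖ ≤ r) (hr1 : r ≤ 1) (hrρ : r ≤ rho0 d L / 4)
    (hsmall : 512 * (d + 1) * (d + 4) * (L : ℝ) ^ 2 * (a + 8 * r) ≤ 1) (y : Site d) (κ : Fin d)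
    (hbr : ‖cpush L V (gaugeExtract V Λ R) y κ‖ + 2 * (r / rho0 d L) ^ 2 ≤ 1 / 32) :
    ‖relStep L V (gaugeDir V Λ + R) y κ
        - mlog (exp (Ad (cavg L V y κ)⁻¹ (Λ ((L : ℤ) • y))) * exp (-(Λ ((L : ℤ) • (y + e κ)))))‖
      ≤ 3 * (‖cpush L V (gaugeExtract V Λ R) y κ‖ + 2 * (r / rho0 d L) ^ 2) := by
  have hr0 : 0 ≤ r := (norm_nonneg _).trans (hr y κ)
  have hsmall0 : 512 * (d + 1) * (d + 4) * (L : ℝ) ^ 2 * a ≤ 1 := by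
    have : 512 * (d + 1) * (d + 4) * (L : ℝ) ^ 2 * a ≤ 512 * (d + 1) * (d + 4) * (L : ℝ) ^ 2 * (a + 8 * r) :=
      mul_le_mul_of_nonneg_left (by linarith) (by positivity)
    exact this.trans hsmall
  have hstep : ‖relStep L V (gaugeExtract V Λ R) y κ‖ ≤ ‖cpush L V (gaugeExtract V Λ R) y κ‖ + 2 * (r / rho0 d L) ^ 2 :=
    norm_relStep_le hL hVu ha hsmall0 hVa hr0 hr hrρ y κ
  have h := norm_relStep_gaugeDir_add_sub_corner_le hL hVu ha hVa hΛ hΛs hR hRs hr hr1 hrρ hsmall y κ (hstep.trans hbr)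
  exact h.trans (by linarith)

end

end Summit.QuantumFields.BalabanUV.T4Continuum.NE7OneStepCornerForm
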